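import Literature.NumberTheory.EllipticCurves.Kato2004.ConditionVIffNotHasCMProofs
import Literature.NumberTheory.EllipticCurves.ZywinaCMImageProofs
import HarnessLib

/-!
# K8 Kato side: the Thm. 13.4 road `{hZ, h134(, h12)}` reaches EXACTLY the non-CM Gss2 rows — its row
# hypothesis (Kato's (v) for the twist `W = V^{(p*)}`) holds if and only if `V` has no CM; the CM rows
# never meet crux 20445 (their mod-`p` image is not onto)

Cell `bsd-potss` (HOME `run/shared/lean/pub/bsd-potss/`), seat `bsd-potss-k8q-c2x` g6 (prover; lane B of
the K8 Kato side, route `QuadraticBranchSignedControl`, crux stmt-BirchSwinnertonDyer-20445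
`PlusKatoDivisibilityBranchOnto`, aside 21377 `PlusKatoDivisibilityBranch`, residual crux 19606
`PlusEtaMainConjectureNonsurj`).  HONEST FRAMING: the programme assembles BSD for analytic rank `≤ 1`
strictly from published theorems and types the remainder; BSD is not proved by any of this; the theorems
below are UNCONDITIONAL statements about Galois images (no named fact is consumed); nothing is closed or
booked; BSD is claimed for no curve.

## What (record, kernel-certified both ways)

Lane B's Kato-side road derives Kobayashi Thm. 4.1/2.2 at `η` and (RK⁺) for a Gss2 row `V` (globally
minimal, `p ≥ 5` good, `a_p(V) = 0`) from `hZ` (Kobayashi's Coleman/Poitou–Tate package at `η` with `z`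
an Euler-system class) and `h134` (Kato Thm. 13.4) under ONE row hypothesis — Kato's (v) for the twist
`W = V^{(p*)}`: `hv : ∃ σ ∈ Gal(ℚ̄/ℚ(ζ_{p^∞})), rank_{ℤ_p} Coker(ρ_{W,p}(σ) − 1) = 1`
(`EulerSystemBound.quadraticBranchPlusKatoDivisibilityAt_of_zeta_of_thm13_4_of_thm12`, g2).  g5 proved `hv`
for every non-CM `V` (Serre's open image); g6 proved `¬ hv` for every CM `V` (Cartan-normaliser
dichotomy, `Kato2004.not_exists_finrank_coker_eq_one_quadraticTwist_of_hasCM`).  Hence: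

* §1 `KatoSideCM.rowConditionV_iff_not_hasCM` — **the row hypothesis of the 13.4 road holds iff `V` has
  no CM** (`p` odd, `V` globally minimal): the road reaches exactly the non-CM rows; on the CM rows of the
  aside 21377 / of crux 19606 the printed Kato side is Kato Thm. 12.5 via §15 (`h41`, glue 19614) or
  Burungale–Tian 2026 Thm. 2.6 up to `μ` (lane A), never Thm. 13.4.
* §2 `KatoSideCM.not_forall_hasSurjectiveModNGaloisRep_of_hasCM` — **a CM row is never tower-onto**
  (`ρ̄_{V,p}` is not onto for CM `V` and odd `p`, `WeierstrassCurve.not_hasSurjectiveModNGaloisRep_of_hasCM`,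
  Serre 1972 §4.5): the CM rows lie in the non-onto branch of the deciding theorem `closes`
  (`PlusMainConjectureNonsurjBranch` / 19606), so crux 20445 (`PlusKatoDivisibilityBranchOnto`, tower-onto
  rows) ranges over non-CM rows only — where (v) is a theorem — and `{hZ, h134, h12}` settle it with no
  case distinction (glue 21365, g5).
* §3 `KatoSideCM.rowConditionV_of_forall_hasSurjectiveModNGaloisRep` — on 20445's own rows the binder
  `hv` is discharged two ways (Kato (12.5.2) from tower-onto, g2; or non-CM by §2 + open image, g5).

References: [Kato2004Asterisque] Thm. 13.4 (v) and the remark after it (p. 226), (12.5.2) (p. 222), §15;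
[Serre1972] §2.2, §4.5; [SerreAbelianLadic1968] IV-11; [Kobayashi2003] Thm. 4.1 (p. 8);
[BurungaleTian2026] Thm. 2.6.
-/

noncomputable section

-- justification: the `Summit.BirchSwinnertonDyer.BirchSwinnertonDyer.…` path repeats a component (route-file convention)
set_option linter.dupNamespace false

open scoped Classical

open Field WeierstrassCurve
open Literature.NumberTheory.EllipticCurves
open Literature.NumberTheory.GaloisRepresentations

namespace Summit.BirchSwinnertonDyer.BirchSwinnertonDyer.Theorems

namespace KatoSideCM

variable {p : ℕ} [Fact p.Prime]

/-! ## §1 The row hypothesis of the 13.4 road holds iff the row is non-CM -/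

/-- **The row hypothesis `hv` of lane B's Kato-side road — Kato's Thm. 13.4 (v) for the `p*`-twist
`W = V^{(p*)}` — holds if and only if `V` has no complex multiplication** (`p` odd, `V/ℚ` globally
minimal; the `∀ [W.IsElliptic]` binder is the shape of `hv` in
`EulerSystemBound.quadraticBranchPlusKatoDivisibilityAt_of_zeta_of_thm13_4_of_thm12`).  `⟸`: g5's
`Kato2004.exists_finrank_coker_eq_one_quadraticTwist_primeStar_of_not_hasCM` (open image + twist
transport); `⟹`: g6's `Kato2004.not_exists_finrank_coker_eq_one_quadraticTwist_of_hasCM` (a twist of a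
CM curve is CM; Cartan-normaliser dichotomy on `T_pW`).  UNCONDITIONAL.
[cite: Kato2004Asterisque, Thm. 13.4 (v) and the remark after it (p. 226)] [cite: Serre1972, §2.2 and §4.5]
[cite: SerreAbelianLadic1968, Ch. IV §2.2 Théorème (IV-11)] -/
theorem rowConditionV_iff_not_hasCM (hp2 : p ≠ 2) (V : WeierstrassCurve ℚ) [V.IsElliptic]
    [V.IsGloballyMinimal] :
    (∀ [(V.quadraticTwist (((-1 : ℚ) ^ (p / 2)) * p)).IsElliptic],
      ∃ σ : absoluteGaloisGroup ℚ,
        (∀ (n : ℕ) (t : AlgebraicClosure ℚ), t ^ p ^ n = 1 → σ • t = t) ∧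
          Module.finrank ℤ_[p]
            (((V.quadraticTwist (((-1 : ℚ) ^ (p / 2)) * p)).tateModule p) ⧸
              LinearMap.range
                ((V.quadraticTwist (((-1 : ℚ) ^ (p / 2)) * p)).galoisRepTate p σ - 1)) = 1) ↔
      ¬ V.HasCM := by
  have hp : p.Prime := Fact.out
  have hc : (((-1 : ℚ) ^ (p / 2)) * p) ≠ 0 :=
    mul_ne_zero (pow_ne_zero _ (by norm_num)) (Nat.cast_ne_zero.mpr hp.ne_zero)
  haveI : (V.quadraticTwist (((-1 : ℚ) ^ (p / 2)) * p)).IsElliptic := V.isElliptic_quadraticTwist hc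
  refine ⟨fun h hCM ↦ ?_, fun hV _ ↦ ?_⟩
  · exact Kato2004.not_exists_finrank_coker_eq_one_quadraticTwist_of_hasCM V hCM hc p h
  · exact Kato2004.exists_finrank_coker_eq_one_quadraticTwist_primeStar_of_not_hasCM hp2 V hV

/-- **On a CM row the 13.4 road is void**: for CM `V/ℚ` (globally minimal), odd `p`, the row
hypothesis `hv` (Kato's (v) for `V^{(p*)}`) is FALSE.  So `{hZ, h134}` say nothing about the CM rows of
the aside `PlusKatoDivisibilityBranch` (21377) or of crux 19606; their printed Kato side is Thm. 12.5 via
§15 (elliptic units), held as `h41` in glue 19614. UNCONDITIONAL.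
[cite: Kato2004Asterisque, Thm. 13.4 (v) and the remark after it (p. 226); §15] -/
theorem not_rowConditionV_of_hasCM (hp2 : p ≠ 2) (V : WeierstrassCurve ℚ) [V.IsElliptic]
    [V.IsGloballyMinimal] (hCM : V.HasCM) :
    ¬ (∀ [(V.quadraticTwist (((-1 : ℚ) ^ (p / 2)) * p)).IsElliptic],
      ∃ σ : absoluteGaloisGroup ℚ,
        (∀ (n : ℕ) (t : AlgebraicClosure ℚ), t ^ p ^ n = 1 → σ • t = t) ∧
          Module.finrank ℤ_[p]
            (((V.quadraticTwist (((-1 : ℚ) ^ (p / 2)) * p)).tateModule p) ⧸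
              LinearMap.range
                ((V.quadraticTwist (((-1 : ℚ) ^ (p / 2)) * p)).galoisRepTate p σ - 1)) = 1) :=
  fun h ↦ (rowConditionV_iff_not_hasCM hp2 V).mp h hCM

/-! ## §2 CM rows are never tower-onto: crux 20445 ranges over non-CM rows only -/

/-- **A CM row is never tower-onto**: for CM `V/ℚ` and odd `p`, `ρ̄_{V,p^m}` is not onto for all `m`
(already `ρ̄_{V,p}` is not onto: the image normalises a Cartan subgroup and contains no transvection,
`WeierstrassCurve.not_hasSurjectiveModNGaloisRep_of_hasCM`, Serre 1972 §4.5).  Consequence for the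
route: the CM rows lie in the NON-onto branch of `closes` (`PlusMainConjectureNonsurjBranch`, crux
19606), and crux 20445 `PlusKatoDivisibilityBranchOnto` never meets a CM row. UNCONDITIONAL.
[cite: Serre1972, §4.5] -/
theorem not_forall_hasSurjectiveModNGaloisRep_of_hasCM (hp2 : p ≠ 2) (V : WeierstrassCurve ℚ)
    [V.IsElliptic] (hCM : V.HasCM) : ¬ ∀ m : ℕ, V.HasSurjectiveModNGaloisRep (p ^ m : ℕ) := by
  intro h
  have h1 := h 1
  rw [pow_one] at h1
  exact V.not_hasSurjectiveModNGaloisRep_of_hasCM hCM (Fact.out : p.Prime) hp2 h1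

/-- **A tower-onto row has no CM** (contrapositive of `not_forall_hasSurjectiveModNGaloisRep_of_hasCM`):
the domain of crux 20445 consists of non-CM rows. [cite: Serre1972, §4.5] -/
theorem not_hasCM_of_forall_hasSurjectiveModNGaloisRep (hp2 : p ≠ 2) (V : WeierstrassCurve ℚ)
    [V.IsElliptic] (hsurj : ∀ m : ℕ, V.HasSurjectiveModNGaloisRep (p ^ m : ℕ)) : ¬ V.HasCM :=
  fun hCM ↦ not_forall_hasSurjectiveModNGaloisRep_of_hasCM hp2 V hCM hsurj

/-! ## §3 On 20445's rows the binder `hv` is a theorem two ways -/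

/-- **On a tower-onto row the row hypothesis `hv` holds** — here obtained through §2 (no CM) and §1
(open image), independently of Kato's (12.5.2) road
(`Kato2004.exists_finrank_coker_eq_one_of_smul_eq_quadraticTwist_primeStar_of_forall_hasSurjectiveModNGaloisRep`,
g2/g4): the two discharges of `hv` on crux 20445's domain agree. UNCONDITIONAL.
[cite: Kato2004Asterisque, (12.5.2) (p. 222) and Thm. 13.4 (v) (p. 226)]
[cite: SerreAbelianLadic1968, Ch. IV §2.2 Théorème (IV-11)] -/
theorem rowConditionV_of_forall_hasSurjectiveModNGaloisRep (hp2 : p ≠ 2) (V : WeierstrassCurve ℚ)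
    [V.IsElliptic] [V.IsGloballyMinimal] (hsurj : ∀ m : ℕ, V.HasSurjectiveModNGaloisRep (p ^ m : ℕ)) :
    ∀ [(V.quadraticTwist (((-1 : ℚ) ^ (p / 2)) * p)).IsElliptic],
      ∃ σ : absoluteGaloisGroup ℚ,
        (∀ (n : ℕ) (t : AlgebraicClosure ℚ), t ^ p ^ n = 1 → σ • t = t) ∧
          Module.finrank ℤ_[p]
            (((V.quadraticTwist (((-1 : ℚ) ^ (p / 2)) * p)).tateModule p) ⧸
              LinearMap.range
                ((V.quadraticTwist (((-1 : ℚ) ^ (p / 2)) * p)).galoisRepTate p σ - 1)) = 1 :=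
  (rowConditionV_iff_not_hasCM hp2 V).mpr (not_hasCM_of_forall_hasSurjectiveModNGaloisRep hp2 V hsurj)

end KatoSideCM

end Summit.BirchSwinnertonDyer.BirchSwinnertonDyer.Theorems

end
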